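import Mathlib.Analysis.Calculus.FDeriv.Symmetric
import Mathlib.Analysis.Calculus.Deriv.Mul
import Mathlib.Analysis.SpecialFunctions.Exponential
import Mathlib.Analysis.Calculus.InverseFunctionTheorem.ContDiff
import Mathlib.Analysis.Calculus.ContDiff.Comp
import Literature.NumberTheory.Automorphic.RealMatrixGroupsExpOpen
import Literature.NumberTheory.Automorphic.ArchFlowParametricIntegral
import HarnessLib

/-!
# The archimedean calculus for a linear real group with FULL Lie algebra: `X φ` is smooth and
`[X, Y] φ = X (Y φ) - Y (X φ)` (Borel–Jacquet §1.5), from the von Neumann–Cartan theorem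

Topic `NumberTheory/Automorphic`. Let `H : RealMatrixGroup A N` be a linear real group over a
finite-dimensional coefficient algebra whose Lie algebra `𝔤 = H.lie` is *full* — every matrix `X` with
`exp (tX) ∈ H` for all `t` lies in `𝔤` (the hypothesis `hreg`; it is the field
`AutomorphyDatum.IsRegular.mem_lie_of_expGL_mem` of a regular automorphy datum, `AutomorphicForms`).
The tree proves the two calculus facts of `ArchimedeanCalculus` —

* `isArchSmooth_lieDeriv` : Lie derivatives `X φ` of functions smooth in the archimedean variable are
  smooth in the archimedean variable (Borel–Jacquet 1979, §1.5; Wallach I, 1.6.2), and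
* the bracket relation `[X, Y] φ = X (Y φ) - Y (X φ)` behind `applyFree_congr` (Borel–Jacquet §1.5;
  Knapp 2002, I.§10, Prop. 1.89)

— only for the full linear group `𝔤 = 𝔤𝔩(N, A)` (`isArchSmooth_lieDeriv_of_lie_eq_top`,
`lieDeriv_bracket_of_top`), where the exponential chart needs no group theory. This file proves both
for every `H` with full Lie algebra:

* `exists_contDiffAt_log_inverse` — a smooth local logarithm with `exp ∘ log = id` near `1` AND
  `log ∘ exp = id` near `0` (inverse function theorem);
* `RealMatrixGroup.eventually_nhds_one_exists_expMem` — elements of `H` near `1` are `exp X` with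
  `X ∈ 𝔤` in any prescribed neighbourhood of `0` (the von Neumann–Cartan theorem in the form
  `RealMatrixGroup.map_expMem_nhds_zero` of `RealMatrixGroupsExpOpen`; Hall 2015, Cor. 3.44), hence
  `log h ∈ 𝔤` and `exp (log h) = h` for `h ∈ H` near `1` (`RealMatrixGroup.eventually_log_mem`);
* `isArchSmooth_lieDeriv_of_regular` — **`X φ` is smooth for smooth `φ`** (the named fact
  `isArchSmooth_lieDeriv (ι := ι)` for such `H`): near `(Y₀, 0)`,
  `φ (g ι(exp Y) ι(exp tX)) = Φ (π (log (exp(-Y₀) exp Y exp tX)))` with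
  `Φ = (Z ↦ φ (g ι(exp Y₀) ι(exp Z)))` smooth on `𝔤`, `π` a linear projection onto `𝔤` (the
  logarithm landing in `𝔤` by the previous point, so that `π` does not alter it);
* `lieDeriv_bracket_of_regular` — **the bracket relation** for such `H`: with
  `F(M) = φ (g ι(exp (π (log M))))`, a function on all matrices smooth at `1` and equal to
  `φ (g ι(h))` at `h ∈ H` near `1`, `(Z φ)(g ι(h)) = DF(h)(h Z)` for `h` near `1`,
  `(X (Y φ))(g) = D²F(1)(X, Y) + DF(1)(XY)`, and the symmetric second derivative cancels.

Everything here is proved; no definitions, no named facts. The consequences for `U(𝔤)`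
(`applyFree_congr`) and for automorphic forms are drawn in `ArchimedeanEnvelopingActionRegular`.

## References

* A. Borel, H. Jacquet, *Automorphic forms and automorphic representations*, Proc. Sympos. Pure
  Math. 33 (Corvallis 1977), Part 1 (1979), §1.5 [BorelJacquetCorvallis1979].
* B. C. Hall, *Lie Groups, Lie Algebras, and Representations*, 2nd ed., GTM 222 (2015), Thm. 3.42,
  Cor. 3.44–3.45 [Hall2015].
* A. W. Knapp, *Lie Groups Beyond an Introduction*, 2nd ed. (2002), 0.§3–§4, I.§10 Prop. 1.89
  [Knapp2002].
-/

noncomputable section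

open scoped MatrixGroups Matrix ContDiff Topology
open Filter

namespace Literature.NumberTheory.Automorphic

/-! ### A smooth local logarithm, two-sided -/

section Log

variable {A : Type*} [NormedCommRing A] [NormedAlgebra ℝ A] [CompleteSpace A]
  {N : Type*} [Fintype N] [DecidableEq N]

-- As in `Mathlib/Analysis/Normed/Algebra/MatrixExponential.lean` and `ArchimedeanLieBracket`: the
-- scoped `L∞`-operator normed ring structure on matrices is only reducibly-defeq to the Pi
-- uniformity, so `CompleteSpace (Matrix N N A)` and the analytic facts about `exp` need this setting.
set_option backward.isDefEq.respectTransparency false in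
open scoped Matrix.Norms.Operator in
/-- **A smooth local logarithm, inverse to `exp` on both sides.** There is `log : 𝔤𝔩(N, A) → 𝔤𝔩(N, A)`,
`C^∞` at `1`, with `log 1 = 0`, `exp (log y) = y` for `y` near `1` and `log (exp x) = x` for `x` near
`0` (inverse function theorem at `0`, where `exp` has derivative `1`; `exists_contDiffAt_log` of
`ArchimedeanLieBracket` records only the right inverse). Knapp 2002, 0.§3. [folklore] -/
theorem exists_contDiffAt_log_inverse :
    ∃ log : Matrix N N A → Matrix N N A, ContDiffAt ℝ ∞ log 1 ∧ log 1 = 0 ∧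
      (∀ᶠ y in 𝓝 (1 : Matrix N N A), NormedSpace.exp (log y) = y) ∧
        ∀ᶠ x in 𝓝 (0 : Matrix N N A), log (NormedSpace.exp x) = x := by
  have hexp : ContDiff ℝ ∞ (NormedSpace.exp : Matrix N N A → Matrix N N A) :=
    contDiff_iff_contDiffAt.2 fun M => (NormedSpace.exp_analytic (𝕂 := ℝ) M).contDiffAt
  have hexp0 : HasFDerivAt (NormedSpace.exp : Matrix N N A → Matrix N N A)
      ((ContinuousLinearEquiv.refl ℝ (Matrix N N A) : Matrix N N A ≃L[ℝ] Matrix N N A) :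
        Matrix N N A →L[ℝ] Matrix N N A) 0 :=
    (hasFDerivAt_exp_zero (𝕂 := ℝ) (𝔸 := Matrix N N A)).congr_fderiv (by ext M; simp)
  have hn : (∞ : WithTop ℕ∞) ≠ 0 := by simp
  refine ⟨hexp.contDiffAt.localInverse hexp0 hn, ?_, ?_, ?_, ?_⟩
  · have := hexp.contDiffAt.to_localInverse hexp0 hn
    rwa [NormedSpace.exp_zero] at this
  · have := hexp.contDiffAt.localInverse_apply_image hexp0 hn
    rwa [NormedSpace.exp_zero] at this
  · have := (hexp.contDiffAt.hasStrictFDerivAt' hexp0 hn).eventually_right_inverse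
    rwa [NormedSpace.exp_zero] at this
  · exact (hexp.contDiffAt.hasStrictFDerivAt' hexp0 hn).eventually_left_inverse

end Log

/-! ### Elements of `H` near `1` are exponentials of small elements of `𝔤` -/

section NearOne

variable {A : Type*} [NormedCommRing A] [NormedAlgebra ℝ A] [NormedAlgebra ℚ A] [CompleteSpace A]
  [StarRing A] {N : Type*} [Fintype N] [DecidableEq N] (H : RealMatrixGroup A N)

set_option backward.isDefEq.respectTransparency false in
open scoped Matrix.Norms.Operator in
/-- **The logarithm of an element of `H` near `1` lies in `𝔤`** (von Neumann–Cartan; Hall 2015,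
Cor. 3.44: `exp` maps every neighbourhood of `0` in `𝔤` onto a neighbourhood of `1` in `H`, the form
`RealMatrixGroup.map_expMem_nhds_zero` of `RealMatrixGroupsExpOpen`): for a linear real group with
full Lie algebra over a finite-dimensional coefficient algebra and a local logarithm `log` with
`log (exp x) = x` near `0`, eventually as `h → 1` in `H` one has `log h ∈ 𝔤` and `exp (log h) = h`
(write `h = exp X` with `X ∈ 𝔤` small; then `log h = log (exp X) = X`). [cite: Hall2015, Cor. 3.44] -/
theorem RealMatrixGroup.eventually_nhds_one_log_mem [FiniteDimensional ℝ A]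
    (hreg : ∀ X : Matrix N N A, (∀ t : ℝ, expGL (t • X) ∈ H.carrier) → X ∈ H.lie)
    {log : Matrix N N A → Matrix N N A}
    (hleft : ∀ᶠ x in 𝓝 (0 : Matrix N N A), log (NormedSpace.exp x) = x) :
    ∀ᶠ h : H.carrier in 𝓝 1, log ((h : GL N A) : Matrix N N A) ∈ H.lie ∧
      expGL (log ((h : GL N A) : Matrix N N A)) = (h : GL N A) := by
  -- Mathlib idiom (Mathlib/Algebra/Lie/OfAssociative.lean), needed to name `𝔤.toSubmodule`
  letI : LieRing (Matrix N N A) := LieRing.ofAssociativeRing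
  -- the small elements of `𝔤` on which `log ∘ exp = id`
  have hV : ∀ᶠ X : H.lie.toSubmodule in 𝓝 0,
      log (NormedSpace.exp (X : Matrix N N A)) = (X : Matrix N N A) := by
    have ht : Tendsto (fun X : H.lie.toSubmodule ↦ (X : Matrix N N A)) (𝓝 0) (𝓝 0) := by
      have h := (continuous_subtype_val :
        Continuous fun X : H.lie.toSubmodule ↦ (X : Matrix N N A)).tendsto 0
      rwa [ZeroMemClass.coe_zero] at h
    exact ht.eventually hleft
  have h1 : (fun X : H.lie.toSubmodule ↦ H.expMem ⟨(X : Matrix N N A), X.2⟩) ''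
      {X : H.lie.toSubmodule | log (NormedSpace.exp (X : Matrix N N A)) = (X : Matrix N N A)} ∈
        𝓝 (1 : H.carrier) := by
    rw [← H.map_expMem_nhds_zero hreg]
    exact image_mem_map hV
  filter_upwards [h1]
  rintro _ ⟨X, hX, rfl⟩
  have hlog : log (((H.expMem ⟨(X : Matrix N N A), X.2⟩ : H.carrier) : GL N A) : Matrix N N A) =
      X := by
    rw [RealMatrixGroup.coe_expMem, coe_expGL]
    exact hX
  rw [hlog]
  exact ⟨X.2, rfl⟩

end NearOne

/-! ### Lie derivatives of smooth functions are smooth (full Lie algebra) -/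

section Smooth

variable {A : Type*} [NormedCommRing A] [NormedAlgebra ℝ A] [NormedAlgebra ℚ A] [CompleteSpace A]
  [StarRing A] {N : Type*} [Fintype N] [DecidableEq N] {H : RealMatrixGroup A N}
  {G : Type*} [Group G] (ι : H.carrier →* G)

set_option backward.isDefEq.respectTransparency false in
open scoped Matrix.Norms.Operator in
/-- **Lie derivatives preserve archimedean smoothness for a linear real group with full Lie
algebra.** If every `X` with `exp (tX) ∈ H` (all `t`) lies in `𝔤`, `A` is finite-dimensional and `φ`
is smooth in the archimedean variable, then so is `X φ` for every `X ∈ 𝔤`: near `(Y₀, 0)` the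
element `exp(-Y₀) exp(Y) exp(tX) ∈ H` is close to `1`, hence equals `exp Z` with
`Z = log (exp(-Y₀) exp Y exp tX) ∈ 𝔤` (`RealMatrixGroup.eventually_log_mem`), so
`φ (g ι(exp Y) ι(exp tX)) = Φ (π (log (exp(-Y₀) exp Y exp tX)))` with
`Φ = (Z ↦ φ (g ι(exp Y₀) ι(exp Z)))` smooth on `𝔤` and `π` a linear projection onto `𝔤`; thus
`Y ↦ (X φ)(g ι(exp Y))` is the `t`-derivative at `0` of a function smooth in `(Y, t)`.
Borel–Jacquet 1979, §1.5; Wallach, *Real Reductive Groups I*, 1.6.2; Hall 2015, Cor. 3.44–3.45.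
[cite: BorelJacquetCorvallis1979, §1.5] -/
theorem isArchSmooth_lieDeriv_of_regular [FiniteDimensional ℝ A]
    (hreg : ∀ X : Matrix N N A, (∀ t : ℝ, expGL (t • X) ∈ H.carrier) → X ∈ H.lie) (X : H.lie)
    {φ : G → ℂ} (hφ : IsArchSmooth ι φ) : IsArchSmooth ι (lieDeriv ι X φ) := by
  -- Mathlib idiom (Mathlib/Algebra/Lie/OfAssociative.lean): the commutator Lie ring on matrices
  letI : LieRing (Matrix N N A) := LieRing.ofAssociativeRing
  -- the exponential chart `E : 𝔤 → H` and a continuous linear projection `π : 𝔤𝔩 → 𝔤`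
  set E : H.lie.toSubmodule → H.carrier := fun Y => H.expMem ⟨(Y : Matrix N N A), Y.2⟩ with hE_def
  obtain ⟨q, hpq⟩ := Submodule.exists_isCompl (H.lie.toSubmodule : Submodule ℝ (Matrix N N A))
  let πl : Matrix N N A →ₗ[ℝ] H.lie.toSubmodule := H.lie.toSubmodule.projectionOnto q hpq
  let π : Matrix N N A →L[ℝ] H.lie.toSubmodule := ⟨πl, πl.continuous_of_finiteDimensional⟩
  -- analytic facts about `exp` and the two-sided local logarithm
  have hexp : ContDiff ℝ ∞ (NormedSpace.exp : Matrix N N A → Matrix N N A) :=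
    contDiff_iff_contDiffAt.2 fun M => (NormedSpace.exp_analytic (𝕂 := ℝ) M).contDiffAt
  obtain ⟨log, hlog, -, -, hleft⟩ := exists_contDiffAt_log_inverse (A := A) (N := N)
  have hsub : ContDiff ℝ ∞ (fun Y : H.lie.toSubmodule => (Y : Matrix N N A)) :=
    H.lie.toSubmodule.subtypeL.contDiff
  intro g
  refine contDiff_iff_contDiffAt.2 fun Y₀ => ?_
  -- the two-variable function `(Y, t) ↦ φ (g ι(exp Y) ι(exp tX))`
  set f2 : H.lie.toSubmodule × ℝ → ℂ := fun p => φ (g * ι (E p.1) * ι (H.expMem (p.2 • X)))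
    with hf2_def
  -- Step A: `f2` is smooth at `(Y₀, 0)`, through the exponential chart of `H` at `exp Y₀`
  have hA : ContDiffAt ℝ ∞ f2 (Y₀, 0) := by
    set u₀ : H.carrier := E Y₀ with hu₀
    -- the matrix `P (Y, t) = exp(-Y₀) exp(Y) exp(tX)`, smooth in `(Y, t)`, equal to `1` at `(Y₀, 0)`
    set P : H.lie.toSubmodule × ℝ → Matrix N N A := fun p =>
      (((u₀⁻¹ : H.carrier) : GL N A) : Matrix N N A) *
        (NormedSpace.exp (p.1 : Matrix N N A) * NormedSpace.exp (p.2 • (X : Matrix N N A)))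
      with hP_def
    have hP : ContDiff ℝ ∞ P :=
      contDiff_const.mul (((hexp.comp (hsub.comp contDiff_fst))).mul
        (hexp.comp (contDiff_snd.smul contDiff_const)))
    have hP0 : P (Y₀, 0) = 1 := by
      simp only [hP_def, zero_smul, NormedSpace.exp_zero, mul_one]
      exact Units.inv_mul _
    -- the same element as an element of `H`, continuous in `(Y, t)`, equal to `1` at `(Y₀, 0)`
    set Q : H.lie.toSubmodule × ℝ → H.carrier := fun p =>
      u₀⁻¹ * (E p.1 * H.expMem (p.2 • X)) with hQ_def
    have hQc : Continuous Q := by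
      refine continuous_const.mul ((H.continuous_expMem_mk.comp continuous_fst).mul ?_)
      exact (continuous_expMem_smul X).comp continuous_snd
    have hexp0 : H.expMem ((0 : ℝ) • X) = 1 := by
      refine Subtype.ext (Units.ext ?_)
      change NormedSpace.exp ((((0 : ℝ) • X : H.lie)) : Matrix N N A) = 1
      rw [show ((((0 : ℝ) • X : H.lie)) : Matrix N N A) = (0 : ℝ) • (X : Matrix N N A) from rfl,
        zero_smul, NormedSpace.exp_zero]
    have hQ0 : Q (Y₀, 0) = 1 := by
      simp only [hQ_def]
      rw [hexp0, mul_one, hu₀, inv_mul_cancel]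
    have hval : ∀ p, (((Q p : H.carrier) : GL N A) : Matrix N N A) = P p := fun p => rfl
    -- the smooth candidate `Gf (Y, t) = φ (g ι(u₀) ι(exp (π (log (P (Y, t))))))`
    set Gf : H.lie.toSubmodule × ℝ → ℂ := fun p => φ (g * ι u₀ * ι (E (π (log (P p)))))
      with hGf_def
    have hGf : ContDiffAt ℝ ∞ Gf (Y₀, 0) := by
      have h1 : ContDiffAt ℝ ∞ (fun p : H.lie.toSubmodule × ℝ => log (P p)) (Y₀, 0) := by
        refine ContDiffAt.comp (Y₀, 0) ?_ hP.contDiffAt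
        rwa [hP0]
      exact ((hφ (g * ι u₀)).contDiffAt).comp (Y₀, 0) (π.contDiff.contDiffAt.comp (Y₀, 0) h1)
    -- `f2 = Gf` near `(Y₀, 0)`: the logarithm of `P (Y, t) ∈ H` lies in `𝔤`
    have hnear : Tendsto Q (𝓝 (Y₀, 0)) (𝓝 1) := by
      have := hQc.tendsto (Y₀, 0)
      rwa [hQ0] at this
    have heq : f2 =ᶠ[𝓝 (Y₀, 0)] Gf := by
      filter_upwards [hnear.eventually (H.eventually_nhds_one_log_mem hreg hleft)] with p hp
      -- `hp : log (P p) ∈ 𝔤 ∧ exp (log (P p)) = Q p`, as `↑(Q p) = P p` definitionally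
      have hπL : π (log (P p)) = ⟨log (P p), hp.1⟩ :=
        Submodule.projectionOnto_apply_of_mem_left hpq hp.1
      have hEQ : E (π (log (P p))) = Q p := by
        rw [hπL]
        exact Subtype.ext hp.2
      have key : E p.1 * H.expMem (p.2 • X) = u₀ * E (π (log (P p))) := by
        rw [hEQ]
        simp only [hQ_def, mul_inv_cancel_left]
      simp only [hf2_def, hGf_def]
      rw [mul_assoc g, ← map_mul, key, map_mul, ← mul_assoc]
    exact hGf.congr_of_eventuallyEq heq
  -- Step B: `Y ↦ ∂_t|₀ f2 (Y, t)` is smooth at `Y₀`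
  have hB : ContDiffAt ℝ ∞ (fun Y : H.lie.toSubmodule => fderiv ℝ (fun t : ℝ => f2 (Y, t)) 0) Y₀ := by
    have hunc : (Function.uncurry fun (Y : H.lie.toSubmodule) (t : ℝ) => f2 (Y, t)) = f2 := by
      funext p; rfl
    refine ContDiffAt.fderiv (𝕜 := ℝ) (n := ∞) (m := ∞) (f := fun Y t => f2 (Y, t))
      (g := fun _ => (0 : ℝ)) ?_ contDiffAt_const (le_of_eq rfl)
    rw [hunc]
    exact hA
  have hB' : ContDiffAt ℝ ∞
      (fun Y : H.lie.toSubmodule => fderiv ℝ (fun t : ℝ => f2 (Y, t)) 0 (1 : ℝ)) Y₀ :=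
    hB.clm_apply contDiffAt_const
  -- `(X φ)(g ι(exp Y)) = ∂_t|₀ f2 (Y, t)` by definition of the Lie derivative
  have hFeq : (fun Y : H.lie.toSubmodule => lieDeriv ι X φ (g * ι (E Y))) =
      fun Y => fderiv ℝ (fun t : ℝ => f2 (Y, t)) 0 (1 : ℝ) := by
    funext Y
    rw [fderiv_apply_one_eq_deriv]
    rfl
  change ContDiffAt ℝ ∞ (fun Y : H.lie.toSubmodule => lieDeriv ι X φ (g * ι (E Y))) Y₀
  rw [hFeq]
  exact hB'

/-- **Discharge of the named fact `isArchSmooth_lieDeriv` for linear real groups with full Lie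
algebra**: `isArchSmooth_lieDeriv (ι := ι)` holds for every homomorphism `ι : H → G` as soon as
every `X` with `exp (tX) ∈ H` for all `t` lies in `𝔤 = H.lie` (finite-dimensional coefficients); in
particular for the archimedean inclusion of a regular automorphy datum.
Borel–Jacquet 1979, §1.5. [cite: BorelJacquetCorvallis1979, §1.5] -/
theorem isArchSmooth_lieDeriv_holds_of_regular
    (hreg : ∀ X : Matrix N N A, (∀ t : ℝ, expGL (t • X) ∈ H.carrier) → X ∈ H.lie) :
    isArchSmooth_lieDeriv (ι := ι) :=
  fun X _ hφ => isArchSmooth_lieDeriv_of_regular ι hreg X hφ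

end Smooth


/-! ### The bracket relation (full Lie algebra) -/

section Bracket

variable {A : Type*} [NormedCommRing A] [NormedAlgebra ℝ A] [NormedAlgebra ℚ A] [CompleteSpace A]
  [StarRing A] {N : Type*} [Fintype N] [DecidableEq N] {H : RealMatrixGroup A N}
  {G : Type*} [Group G] (ι : H.carrier →* G)

set_option backward.isDefEq.respectTransparency false in
open scoped Matrix.Norms.Operator in
/-- **The Lie derivative is a Lie algebra action on smooth functions, for a linear real group with
full Lie algebra**: if every `X` with `exp (tX) ∈ H` (all `t`) lies in `𝔤`, `A` is
finite-dimensional and `φ` is smooth in the archimedean variable, then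
`[X, Y] φ = X (Y φ) - Y (X φ)` for all `X, Y ∈ 𝔤`. With `F(M) = φ (g ι(exp (π (log M))))` (`log` a
local logarithm, `π` a linear projection onto `𝔤`) — a function of a matrix variable, smooth at `1`
and equal to `φ (g ι(h))` at the elements `h ∈ H` near `1` (`RealMatrixGroup.eventually_nhds_one_log_mem`)
— one has `(Z φ)(g ι(h)) = DF(h)(h Z)` for `h ∈ H` near `1` and
`(X (Y φ))(g) = D²F(1)(X, Y) + DF(1)(XY)`; the symmetric second derivative cancels in the
antisymmetrisation (the argument of `lieDeriv_bracket_of_top`, localised at `1`).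
Borel–Jacquet 1979, §1.5; Knapp 2002, I.§10, Prop. 1.89; Hall 2015, Cor. 3.44.
[cite: BorelJacquetCorvallis1979, §1.5] -/
theorem lieDeriv_bracket_of_regular [FiniteDimensional ℝ A]
    (hreg : ∀ X : Matrix N N A, (∀ t : ℝ, expGL (t • X) ∈ H.carrier) → X ∈ H.lie)
    (X Y : H.lie) {φ : G → ℂ} (hφ : IsArchSmooth ι φ) :
    lieDeriv ι ⁅X, Y⁆ φ = lieDeriv ι X (lieDeriv ι Y φ) - lieDeriv ι Y (lieDeriv ι X φ) := by
  classical
  -- Mathlib idiom (Mathlib/Algebra/Lie/OfAssociative.lean): the commutator Lie ring on matrices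
  letI : LieRing (Matrix N N A) := LieRing.ofAssociativeRing
  -- the exponential chart `E : 𝔤 → H`, a continuous linear projection `π : 𝔤𝔩 → 𝔤`, a logarithm
  set E : H.lie.toSubmodule → H.carrier := fun Z => H.expMem ⟨(Z : Matrix N N A), Z.2⟩ with hE_def
  obtain ⟨q, hpq⟩ := Submodule.exists_isCompl (H.lie.toSubmodule : Submodule ℝ (Matrix N N A))
  let πl : Matrix N N A →ₗ[ℝ] H.lie.toSubmodule := H.lie.toSubmodule.projectionOnto q hpq
  let π : Matrix N N A →L[ℝ] H.lie.toSubmodule := ⟨πl, πl.continuous_of_finiteDimensional⟩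
  obtain ⟨log, hlog, -, -, hleft⟩ := exists_contDiffAt_log_inverse (A := A) (N := N)
  -- the matrix of an element of `H`
  set val : H.carrier → Matrix N N A := fun h => ((h : GL N A) : Matrix N N A) with hval_def
  have hval1 : val 1 = 1 := rfl
  have hvalt : Tendsto val (𝓝 1) (𝓝 1) :=
    (Units.continuous_val.comp continuous_subtype_val).tendsto' (1 : H.carrier) 1 hval1
  have hexp0 : ∀ Z : H.lie, H.expMem ((0 : ℝ) • Z) = 1 := fun Z => by
    refine Subtype.ext (Units.ext ?_)
    change NormedSpace.exp ((((0 : ℝ) • Z : H.lie)) : Matrix N N A) = 1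
    rw [show ((((0 : ℝ) • Z : H.lie)) : Matrix N N A) = (0 : ℝ) • (Z : Matrix N N A) from rfl,
      zero_smul, NormedSpace.exp_zero]
  funext g
  -- `F(M) = φ (g ι(exp (π (log M))))`, smooth at `1`, equal to `φ (g ι(h))` at `h ∈ H` near `1`
  set F : Matrix N N A → ℂ := fun M => φ (g * ι (E (π (log M)))) with hF_def
  have hF1 : ContDiffAt ℝ ∞ F 1 :=
    ((hφ g).contDiffAt).comp (1 : Matrix N N A) (π.contDiff.contDiffAt.comp (1 : Matrix N N A) hlog)
  have hagree : ∀ᶠ h : H.carrier in 𝓝 1, F (val h) = φ (g * ι h) := by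
    filter_upwards [H.eventually_nhds_one_log_mem hreg hleft] with h hh
    have hπL : π (log (val h)) = ⟨log (val h), hh.1⟩ :=
      Submodule.projectionOnto_apply_of_mem_left hpq hh.1
    have hEh : E (π (log (val h))) = h := by
      rw [hπL]
      exact Subtype.ext hh.2
    simp only [hF_def]
    rw [hEh]
  have hFdiff : ∀ᶠ M in 𝓝 (1 : Matrix N N A), DifferentiableAt ℝ F M := by
    have h1 : ContDiffAt ℝ 1 F 1 := hF1.of_le (by simp)
    filter_upwards [h1.eventually (by simp)] with M hM
    exact hM.differentiableAt one_ne_zero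
  -- first derivatives near `1`: `(Z φ)(g ι(h)) = DF(h)(h Z)` for `h ∈ H` near `1`
  have hD1 : ∀ Z : H.lie, ∀ᶠ h : H.carrier in 𝓝 1,
      lieDeriv ι Z φ (g * ι h) = fderiv ℝ F (val h) (val h * (Z : Matrix N N A)) := by
    intro Z
    -- `F (h exp(tZ)) = φ (g ι(h exp(tZ)))` for `(h, t)` near `(1, 0)`
    have hm : Continuous fun p : H.carrier × ℝ => p.1 * H.expMem (p.2 • Z) :=
      continuous_fst.mul ((continuous_expMem_smul Z).comp continuous_snd)
    have hmt : Tendsto (fun p : H.carrier × ℝ => p.1 * H.expMem (p.2 • Z)) (𝓝 (1, 0)) (𝓝 1) := by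
      refine hm.tendsto' (1, 0) 1 ?_
      change (1 : H.carrier) * H.expMem ((0 : ℝ) • Z) = 1
      rw [hexp0, mul_one]
    have hpull : ∀ᶠ p : H.carrier × ℝ in 𝓝 (1, 0),
        F (val (p.1 * H.expMem (p.2 • Z))) = φ (g * ι (p.1 * H.expMem (p.2 • Z))) :=
      hmt.eventually hagree
    rw [nhds_prod_eq] at hpull
    filter_upwards [hpull.curry, hvalt.eventually hFdiff] with h hh hdiff
    -- the curve `t ↦ h exp(tZ)` read in matrices, and the chain rule
    have hγ : HasDerivAt (fun t : ℝ => val h * NormedSpace.exp (t • (Z : Matrix N N A)))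
        (val h * (Z : Matrix N N A)) 0 := by
      have := (hasDerivAt_exp_smul_const' (𝕂 := ℝ) (Z : Matrix N N A) (0 : ℝ)).const_mul (val h)
      simpa using this
    have hcomp : HasDerivAt (fun t : ℝ => F (val h * NormedSpace.exp (t • (Z : Matrix N N A))))
        (fderiv ℝ F (val h) (val h * (Z : Matrix N N A))) 0 := by
      have hFd : DifferentiableAt ℝ F (val h * NormedSpace.exp ((0 : ℝ) • (Z : Matrix N N A))) := by
        rw [zero_smul, NormedSpace.exp_zero, mul_one]
        exact hdiff
      have := hFd.hasFDerivAt.comp_hasDerivAt (0 : ℝ) hγ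
      rwa [zero_smul, NormedSpace.exp_zero, mul_one] at this
    have hev : (fun t : ℝ => φ (g * ι h * ι (H.expMem (t • Z)))) =ᶠ[𝓝 0]
        fun t : ℝ => F (val h * NormedSpace.exp (t • (Z : Matrix N N A))) := by
      filter_upwards [hh] with t ht
      have ht' : F (val (h * H.expMem (t • Z))) = φ (g * ι (h * H.expMem (t • Z))) := ht
      rw [mul_assoc, ← map_mul, ← ht']
      rfl
    change deriv (fun t : ℝ => φ (g * ι h * ι (H.expMem (t • Z)))) 0 = _
    rw [hev.deriv_eq, hcomp.deriv]
  -- second derivatives: `(X (Y φ))(g) = D²F(1)(X, Y) + DF(1)(X Y)`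
  have hD2 : ∀ X Y : H.lie, lieDeriv ι X (lieDeriv ι Y φ) g =
      fderiv ℝ (fderiv ℝ F) 1 (X : Matrix N N A) (Y : Matrix N N A) +
        fderiv ℝ F 1 ((X : Matrix N N A) * (Y : Matrix N N A)) := by
    intro X Y
    have hγ : HasDerivAt (fun s : ℝ => NormedSpace.exp (s • (X : Matrix N N A))) (X : Matrix N N A) 0 := by
      simpa using hasDerivAt_exp_smul_const' (𝕂 := ℝ) (X : Matrix N N A) (0 : ℝ)
    -- the values of `Y φ` along `s ↦ exp(sX)`, for `s` near `0`
    have hXt : Tendsto (fun s : ℝ => H.expMem (s • X)) (𝓝 0) (𝓝 1) :=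
      (continuous_expMem_smul X).tendsto' 0 1 (hexp0 X)
    have hvals : (fun s : ℝ => lieDeriv ι Y φ (g * ι (H.expMem (s • X)))) =ᶠ[𝓝 0] fun s : ℝ =>
        fderiv ℝ F (NormedSpace.exp (s • (X : Matrix N N A)))
          (NormedSpace.exp (s • (X : Matrix N N A)) * (Y : Matrix N N A)) := by
      filter_upwards [hXt.eventually (hD1 Y)] with s hs
      rw [hs]
      rfl
    -- `fderiv F` is differentiable at `1`
    have hF2 : HasFDerivAt (fderiv ℝ F) (fderiv ℝ (fderiv ℝ F) 1) (1 : Matrix N N A) := by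
      have h := hF1.fderiv_right (m := 1) (WithTop.coe_le_coe.2 le_top)
      exact (h.differentiableAt (by simp)).hasFDerivAt
    have hc : HasDerivAt (fun s : ℝ => fderiv ℝ F (NormedSpace.exp (s • (X : Matrix N N A))))
        (fderiv ℝ (fderiv ℝ F) 1 (X : Matrix N N A)) 0 := by
      have hF2' : HasFDerivAt (fderiv ℝ F) (fderiv ℝ (fderiv ℝ F) 1)
          (NormedSpace.exp ((0 : ℝ) • (X : Matrix N N A))) := by
        rwa [zero_smul, NormedSpace.exp_zero]
      exact HasFDerivAt.comp_hasDerivAt (l := fderiv ℝ F)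
        (f := fun s : ℝ => NormedSpace.exp (s • (X : Matrix N N A))) (0 : ℝ) hF2' hγ
    have hu : HasDerivAt (fun s : ℝ => NormedSpace.exp (s • (X : Matrix N N A)) * (Y : Matrix N N A))
        ((X : Matrix N N A) * (Y : Matrix N N A)) 0 := hγ.mul_const _
    have hboth := hc.clm_apply hu
    simp only [zero_smul, NormedSpace.exp_zero, one_mul] at hboth
    change deriv (fun s : ℝ => lieDeriv ι Y φ (g * ι (H.expMem (s • X)))) 0 = _
    rw [hvals.deriv_eq, hboth.deriv]
  -- the value of `[X, Y] φ` at `g`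
  have hXY : lieDeriv ι ⁅X, Y⁆ φ g =
      fderiv ℝ F 1 ((X : Matrix N N A) * (Y : Matrix N N A)) -
        fderiv ℝ F 1 ((Y : Matrix N N A) * (X : Matrix N N A)) := by
    have h := (hD1 ⁅X, Y⁆).self_of_nhds
    rw [map_one, mul_one, hval1, one_mul, LieSubalgebra.coe_bracket, Ring.lie_def, map_sub] at h
    exact h
  -- symmetry of the second derivative
  have hsymm : IsSymmSndFDerivAt ℝ F (1 : Matrix N N A) := by
    have h2 : (2 : WithTop ℕ∞) ≤ ∞ := ENat.natCast_le_of_coe_top_le_withTop le_rfl 2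
    exact hF1.isSymmSndFDerivAt (n := ∞) (by simpa using h2)
  rw [Pi.sub_apply, hD2 X Y, hD2 Y X, hXY, hsymm (X : Matrix N N A) (Y : Matrix N N A)]
  abel

end Bracket

end Literature.NumberTheory.Automorphic
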